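import Summits.BirchSwinnertonDyer.BirchSwinnertonDyer.Theorems.TeichmullerTwistDescentAssembly
import Summits.BirchSwinnertonDyer.BirchSwinnertonDyer.Theorems.TeichmullerTwistDescentKummerCornerGlue
import Summits.BirchSwinnertonDyer.BirchSwinnertonDyer.Theorems.TeichmullerTwistDescentWeilTypeManinGlue
import Summits.BirchSwinnertonDyer.BirchSwinnertonDyer.Theorems.TeichmullerTwistDescentPrincipalSeriesOptimalManinUnitOfCells
import Summits.BirchSwinnertonDyer.BirchSwinnertonDyer.Theorems.TeichmullerTwistDescentSupercuspidalOptimalManinUnitFiveSevenOfCell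
import HarnessLib

/-!
# Route `TeichmullerTwistDescent`: the rung W-ALL/2.p>=5.r1 from the route's AKR cruxes, its PUB bundles and ONE
# further printed fact (three-copy Ihara); the whole Manin side of the route from two printed facts — `--supports`

Cell `pub/bsd-wall` (D-0145 line route-BirchSwinnertonDyer-TeichmullerTwistDescent, OPEN rev 5), seat
`bsd-line-ttd-p2` (prover 2/2, g3), item of record PSMU (stmt-BirchSwinnertonDyer-22638). THEOREMS ONLY (no definition,
no named fact, no `sorry`); nothing is closed by name, no item is booked, BSD is not proved by this.

STATUS LINE THIS FILE MAKES KERNEL-CHECKED. After the landings of this seat's g2 (`…CellsOfKatoIhara.lean`,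
`…KummerCornerGlue.lean`, `…CellsByNameFromKato.lean`) every Manin-side declaration of the route file — PSMU (22638),
SCMU57 (22639), CORNER (23883) = WILD (24306) ∧ TAME (24307), LOW (23884), GE11 (23885) — is a tree theorem GRANTED
modularity (`exists_isNewformOf`), Kato's fact F″ (`kato_neron_isIntegral_twistedSymbolSum_of_additive_five_le`) and the
three-copy Ihara lemma (`ModularForms.diamondRibet1997_iharaLemma_sq`), all cite-only and printed. This file records:

* `maninSide_of_kato_of_iharaSq` — the conjunction of all SEVEN Manin-side route decls from {`exists_isNewformOf`, F″,
  Ihara³}; `maninSide_of_pubBundles_of_iharaSq` — the same keyed on the route's REGISTERED bundles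
  `KatoNeronAndCremonaFacts` (23789) and `PublishedInputsAdditiveKoly` (20137) plus Ihara³ (GE11 uses F″ alone).
* `wAllExclAdditiveFiveLeRankOne_of_akr_of_pubBundles_of_iharaSq` — **the rung `Summit.BirchSwinnertonDyer.WAllExclAdditiveFiveLeRankOne`
  GRANTED exactly: the three AKR-shared open cruxes `KolyvaginPrimitiveAdditive` (21400), `RankZeroAdditive` (20133),
  `OffSharpRankOneAdditive` (20134); the three hypothesis-only PUB bundles `PublishedInputsAdditiveKoly` (20137),
  `PublishedManinFacts` (22230), `KatoNeronAndCremonaFacts` (23789); and Ihara³** — through the route's landed assembly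
  (`TeichmullerTwistDescentAssembly.assembly_proof`, item 22641) with PSMU / SCMU57 / G-WT discharged.
* `wAllExclAdditiveFiveLeRankOne_of_closes_of_pubBundles_of_iharaSq` — the same through the route's deciding theorem
  `Theses.TeichmullerTwistDescent.closes` itself (all twelve hypotheses fed: CORNER, LOW, GE11 from the bundles + Ihara³, the
  three closed twins/glue by their `_proof`s), so the board reads the route's residual off ONE kernel-checked term:
  W-ALL/2.p>=5.r1 ⟸ {21400, 20133, 20134} ∪ {20137, 22230, 23789} ∪ {Ihara³}.

HONEST STATUS (numbers): open NON-bundle antecedents of the rung on this route = 3 (all AKR Kolyvagin-side, open in print);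
cite-only printed facts behind the Manin side = 3 (modularity — inside 20137 —, F″ — inside 23789 —, Ihara³ — in NO bundle:
the one by-name gap between the landed theorems and the filed items CORNER/LOW/WILD/TAME/PSMU/SCMU57). `proof.conditional`
by design; BSD is not proved by this; no W-ALL class theorem is proved by this.
[cite: Kato2004Asterisque, (8.1.3) (p. 180), Thm. 9.7 (p. 189)] [cite: KimNakamura2020, Cor. 2.4]
[cite: DiamondRibet1997, §4.5 Lemma 4.6 (p. 371)] [cite: DarmonDiamondTaylor1995, §4.5 p. 137] [cite: BCDTJAMS2001, Thm. A]
-/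

set_option autoImplicit false
-- single-conjunct summit: `Summit.BirchSwinnertonDyer.BirchSwinnertonDyer.…` repeats the name by design
set_option linter.dupNamespace false

noncomputable section

open Literature.NumberTheory.EllipticCurves Literature.NumberTheory.EllipticCurves.ModularForms
  Summit.BirchSwinnertonDyer.BirchSwinnertonDyer.Theses.TeichmullerTwistDescent
  Summit.BirchSwinnertonDyer.BirchSwinnertonDyer.Theorems

namespace Summit.BirchSwinnertonDyer.BirchSwinnertonDyer.Theorems.TeichmullerTwistDescent

/-! ### §1 The whole Manin side of the route from two printed facts (+ modularity) -/

/-- **All seven Manin-side declarations of route `TeichmullerTwistDescent` — PSMU, SCMU57, CORNER, LOW, WILD, TAME, GE11 —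
GRANTED modularity (`hnf`), Kato's fact F″ (`hK`) and the three-copy Ihara lemma (`hI`).** Pure assembly of this seat's
landed conditional theorems (`…_of_kato_of_iharaSq`, `…GeEleven_of_kato57facts`); GE11 uses neither `hnf` nor `hI`. CONDITIONAL; nothing
is closed by this; BSD is not proved by this. [cite: Kato2004Asterisque, (8.1.3) (p. 180), Thm. 9.7 (p. 189)]
[cite: DiamondRibet1997, §4.5 Lemma 4.6 (p. 371)] -/
theorem maninSide_of_kato_of_iharaSq (hnf : exists_isNewformOf)
    (hK : kato_neron_isIntegral_twistedSymbolSum_of_additive_five_le) (hI : diamondRibet1997_iharaLemma_sq) :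
    PrincipalSeriesOptimalManinUnit ∧ SupercuspidalOptimalManinUnitFiveSeven ∧
      KummerCornerTorsionOptimalManinUnit ∧ SupersingularTorsionOptimalManinUnitFive ∧
      KummerCornerWildManinUnit ∧ KummerCornerTameManinUnit ∧ OrdinaryLowValuationOptimalManinUnitGeEleven :=
  ⟨principalSeriesOptimalManinUnit_of_kato_of_iharaSq hnf hK hI,
    supercuspidalOptimalManinUnitFiveSeven_of_kato_of_iharaSq hnf hK hI,
    kummerCornerTorsionOptimalManinUnit_of_kato_of_iharaSq hnf hK hI,
    supersingularTorsionOptimalManinUnitFive_of_kato_of_iharaSq hnf hK hI,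
    kummerCornerWildManinUnit_of_kato_of_iharaSq hnf hK hI,
    kummerCornerTameManinUnit_of_kato_of_iharaSq hnf hK hI,
    ordinaryLowValuationOptimalManinUnitGeEleven_of_kato57facts hK⟩

/-- **The same seven declarations keyed on the route's REGISTERED bundles** `KatoNeronAndCremonaFacts` (23789: F″ ∧ Cremona)
and `PublishedInputsAdditiveKoly` (20137: modularity inside), plus Ihara³ — the antecedent shape of the twins the planner
can file («KatoNeronAndCremonaFacts → PublishedInputsAdditiveKoly → Ihara → X», each closing by `exact (… hKC hP hI).k`).
CONDITIONAL; nothing is closed by this; BSD is not proved by this. [cite: DiamondRibet1997, §4.5 Lemma 4.6 (p. 371)] -/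
theorem maninSide_of_pubBundles_of_iharaSq (hKC : KatoNeronAndCremonaFacts) (hP : PublishedInputsAdditiveKoly)
    (hI : diamondRibet1997_iharaLemma_sq) :
    PrincipalSeriesOptimalManinUnit ∧ SupercuspidalOptimalManinUnitFiveSeven ∧
      KummerCornerTorsionOptimalManinUnit ∧ SupersingularTorsionOptimalManinUnitFive ∧
      KummerCornerWildManinUnit ∧ KummerCornerTameManinUnit ∧ OrdinaryLowValuationOptimalManinUnitGeEleven :=
  maninSide_of_kato_of_iharaSq hP.2.2.2.2.2.1 hKC.1 hI

/-! ### §2 The rung W-ALL/2.p>=5.r1 from the AKR cruxes, the PUB bundles and Ihara³ -/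

/-- **The rung `WAllExclAdditiveFiveLeRankOne` (W-ALL/2.p>=5.r1) GRANTED exactly the route's three AKR-shared open cruxes
(`KolyvaginPrimitiveAdditive` 21400, `RankZeroAdditive` 20133, `OffSharpRankOneAdditive` 20134), its three hypothesis-only
PUB bundles (`PublishedInputsAdditiveKoly` 20137, `PublishedManinFacts` 22230, `KatoNeronAndCremonaFacts` 23789) and the
three-copy Ihara lemma** — through the landed assembly `assembly_proof` (22641) with PSMU and SCMU57 supplied by §1 and the
Weil-type glue G-WT by its landed proof. So the route's live residual is the Kolyvagin side {21400, 20133, 20134}; its Manin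
side costs print only. CONDITIONAL; no item is closed by this; BSD is not proved and no W-ALL class theorem is proved by
this. [cite: Kato2004Asterisque, (8.1.3) (p. 180), Thm. 9.7 (p. 189)] [cite: DiamondRibet1997, §4.5 Lemma 4.6 (p. 371)]
[cite: WZhang2014, Thm. 1.1 (shape of the Kolyvagin-side cruxes)] -/
theorem wAllExclAdditiveFiveLeRankOne_of_akr_of_pubBundles_of_iharaSq
    (h₁ : KolyvaginPrimitiveAdditive) (h₀ : RankZeroAdditive) (hoff : OffSharpRankOneAdditive)
    (hP : PublishedInputsAdditiveKoly) (hF : PublishedManinFacts) (hKC : KatoNeronAndCremonaFacts)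
    (hI : diamondRibet1997_iharaLemma_sq) :
    Summit.BirchSwinnertonDyer.WAllExclAdditiveFiveLeRankOne :=
  TeichmullerTwistDescentAssembly.assembly_proof
    (maninSide_of_pubBundles_of_iharaSq hKC hP hI).1
    (maninSide_of_pubBundles_of_iharaSq hKC hP hI).2.1
    WeilTypeManinGlue.weilTypeManinGlue_proof h₁ h₀ hoff hP hF

/-- **The same rung through the route's own deciding theorem `closes`** (rev 5: twelve hypotheses, USES EVERY ITEM):
CORNER, LOW, GE11 from the bundles + Ihara³ (§1), the closed twins `PrincipalSeriesOptimalManinUnitOfCells` (23886) /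
`SupercuspidalOptimalManinUnitFiveSevenOfCell` (23887) and the closed glue `WeilTypeManinGlue` (22640) by their landed
`_proof`s, the AKR cruxes and the bundles as hypotheses. One kernel-checked term exhibiting the route's residual:
W-ALL/2.p>=5.r1 ⟸ {21400, 20133, 20134} ∪ {20137, 22230, 23789} ∪ {Ihara³}. CONDITIONAL; no item is closed by this;
BSD is not proved by this. [cite: DiamondRibet1997, §4.5 Lemma 4.6 (p. 371)]
[cite: Kato2004Asterisque, (8.1.3) (p. 180), Thm. 9.7 (p. 189)] -/
theorem wAllExclAdditiveFiveLeRankOne_of_closes_of_pubBundles_of_iharaSq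
    (h₁ : KolyvaginPrimitiveAdditive) (h₀ : RankZeroAdditive) (hoff : OffSharpRankOneAdditive)
    (hP : PublishedInputsAdditiveKoly) (hF : PublishedManinFacts) (hKC : KatoNeronAndCremonaFacts)
    (hI : diamondRibet1997_iharaLemma_sq) :
    Summit.BirchSwinnertonDyer.WAllExclAdditiveFiveLeRankOne :=
  closes (maninSide_of_pubBundles_of_iharaSq hKC hP hI).2.2.1 (maninSide_of_pubBundles_of_iharaSq hKC hP hI).2.2.2.1
    (maninSide_of_pubBundles_of_iharaSq hKC hP hI).2.2.2.2.2.2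
    principalSeriesOptimalManinUnitOfCells_proof supercuspidalOptimalManinUnitFiveSevenOfCell_proof
    WeilTypeManinGlue.weilTypeManinGlue_proof h₁ h₀ hoff hP hF hKC

end Summit.BirchSwinnertonDyer.BirchSwinnertonDyer.Theorems.TeichmullerTwistDescent

end
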